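import Mathlib
import HarnessLib
import HarnessLib.Audit
import Summits.Langlands.Statement

/-!
Route: HeptagonalTower

DORMANT since 2026-09-03T09:42:25Z (reconciler: no traction for 5 d (last activity statement-checked at 2026-08-29T08:49:52Z); parked, not closed — `ledger route dormant route-Langlands-HeptagonalTower --off` to reactivate) — unstaffed, not closed; items shared with open routes are served there. `ledger route dormant <id> --off` reactivates.

# Route HeptagonalTower — the real 7-cyclotomic tower — one certified non-vanishing plus Kato makes
every elliptic curve over ℚ(ζ_{7^∞})⁺ modular

It suffices to show X (decl `Target`): every elliptic curve over every totally real number field K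
that embeds in some
ℚ(ζ_{7^{n+1}}) — i.e. every totally real abelian field of 7-power conductor, every layer and
sub-layer of the real 7-cyclotomic tower
ℚ(ζ_{7^∞})⁺ = ∪ₙ ℚ(ζ_{7ⁿ})⁺ (degrees 3·7^{n-1}) — is modular in the tree's sense
(`IsModularEllipticCurve`, inlined: geometric CM, or a
weight-zero cuspidal π of GL₂(𝔸_K) with T_w-eigenvalue a_w(E) at cofinitely many w): the sector of
direction (B) for n = 2, F in the
tower, ρ = V_ℓ(E). X is reduced to ONE arithmetic statement about ONE elliptic curve over ℚ — X₀(15)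
(Legendre model y² = x(x+16)(x+25) over ℚ,
inlined as ⟨0, 41, 0, 400, 0⟩ — definitionally the tree's `X0FifteenLegendre` — Cremona 15A1)
acquires no new points anywhere in the tower — and that statement to a finite 7-adic certificate
(crux
`NonvanishingSevenTwists`) through Kato's twisted rank-zero theorem (`KatoRankZeroSeven`) and
torsion rigidity (`TorsionSeven`); the
door `OddDegreeDoor` (Thorne's mod-5 theorem + Yoshikawa's odd-degree lemma + abelian base change)
turns it into X. X → Langlands is the
support item `SectorComplement` (the honest name for the rest of the summit). No idea card is
realised (operator D, computational witness).
Lean: `∀ (K : Type) [Field K] [NumberField K], NumberField.IsTotallyReal K → (∃ n : ℕ, Nonempty (K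
→+* CyclotomicField ((7 : ℕ+) ^ (n + 1)) ℚ)) → ∀ E : WeierstrassCurve (NumberField.RingOfIntegers
K), E.Δ ≠ 0 → ((E.baseChange K).HasCM ∨ ∃ (hF :
Literature.NumberTheory.Automorphic.isCompact_glFiniteIntegralLevel 2 K) (π :
Literature.NumberTheory.Automorphic.CuspidalAutomorphicRepData 2 K hF), π.1.HasWeightZero ∧ ∀ᶠ w :
IsDedekindDomain.HeightOneSpectrum (NumberField.RingOfIntegers K) in Filter.cofinite, ∃ α : Multiset
ℂ, π.1.HasSatakeParamAt w α ∧ ((Real.sqrt w.residueCard : ℝ) : ℂ) * α.sum =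
(Literature.NumberTheory.Automorphic.frobTraceAt E w : ℂ))`

## Assembly
Pure logic (sorry-free in glue.lean): `closes (hA : Assembly) (hNV : NonvanishingSevenTwists) (hK :
KatoRankZeroSeven) (hD : OddDegreeDoor)
(hT : TorsionSeven) (hC : SectorComplement) : Langlands := hA hNV hK hD hT hC` — modus ponens on the
`Assembly` item, whose statement
`NonvanishingSevenTwists → KatoRankZeroSeven → OddDegreeDoor → TorsionSeven → SectorComplement →
Langlands` is itself pure logic:
`fun hNV hK hD hT hC => hC target` with `target K hK' hemb E hE := hD K hK' hemb (hK hNV K hK' hemb)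
(hT K hK' hemb) E hE`
(proof in hand: grounder evidence HeptagonalAssemblyProof.lean on stmt-Langlands-16843). Every item
is in the cone of `closes`
(route-repair 2026-08-17: the first `closes` inlined this term and left the declared `Assembly` item
unused; the gate does not drop
assembly items, so `closes` now consumes it — no statement changed).

Rationale: WHY THIS LINE. MECHANISM (Iwasawa tower control, new to this summit's routes). For F totally real
with √5 ∉ F, an elliptic curve E/F that is not
modular has ρ̄_{E,5} reducible (Thorne2016 Thm 7.6) and ρ̄_{E,3} Borel or split-Cartan-normaliser
(FreitasLeHungSiksek2015, p = 3 lifting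
+ Langlands–Tunnell), i.e. E is an F-point of X₀(15) = X(b3,b5) or of X(s3,b5) = 15A3, and when
[F:ℚ] is odd the second curve is
slaved to the first by the 2-isogeny 15A3 → 15A1 (Yoshikawa2022 Lemma 3.2 / Cor. 3.3); so for the
odd-degree abelian fields
F ⊂ ℚ(ζ_{7^{n+1}})⁺ (√5 ∉ F automatically) modularity of ALL E/F follows from X₀(15)(F) = X₀(15)(ℚ)
(8 torsion points, j ∈ ℚ ⇒ twist of a
base change of a modular E₀/ℚ along the abelian extension F/ℚ, Langlands1980). Thorne2019 proved
exactly this for the ℤ_p-towers ℚ_∞ of ℚ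
(Kato–Kurihara Iwasawa theory of 15A), Zhang2023 / Yoshikawa2022 for ℤ_p-towers of real quadratic
fields, Yoshikawa2019 for every abelian
field unramified at 3, 5, 7 (Skinner–Wiles door at 3) — which covers the real p-cyclotomic towers
for all p ≥ 11, while p = 2, 3 are
Thorne's and p = 5 contains √5: the real 7-CYCLOTOMIC tower (7 ramified, degrees 3·7ⁿ, base the
heptagon field ℚ(ζ₇)⁺ where
DerickxNajmanSiksek2020 applies) is the one prime-power tower left, and there the only remaining
tool is point control on X₀(15).
New here: (i) the rank part is NOT an Iwasawa-main-conjecture finiteness statement but Kato's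
character-by-character theorem
(Kato2004Asterisque §14, Cor. 14.3 as printed for twists of weight-2 newforms: L(15A, χ, 1) ≠ 0 ⇒
the χ-part of 15A(ℚ(χ)) is finite) fed by the non-vanishing of L(f₁₅ ⊗ χ, 1)
for EVERY even Dirichlet character χ of 7-power conductor — an infinite family of exact statements
that a FINITE 7-adic computation
certifies: a_7(15A) = 0 (supersingular, #X₀(15)(𝔽₇) = 8), so Pollack's plus/minus 7-adic L-functions
(Pollack2003) on the three even
branches ω⁰, ω², ω⁴ of Δ = Gal(ℚ(ζ₇)/ℚ) interpolate all these values; μ = 0 and the Newton polygon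
of each branch (computable from finitely
many 7-adic digits of finitely many modular-symbol Riemann sums) leave only finitely many layers
where a zero could sit at ζ_{7ⁿ} − 1,
each settled by an exact Birch modular-symbol sum; in the expected case λ^± = μ^± = 0 the
certificate is three numbers (the algebraic
parts of L(15A,1) = Ω/8 and of the two cubic-twisted values at conductor 7); (ii) the Δ-isotypic
(tame-twisted) branches, absent from
the ℤ_p-tower papers; (iii) torsion is rigid for free in odd-degree abelian towers (ρ̄_{15A,ℓ} =
GL₂(𝔽_ℓ) for odd ℓ and ℓ² − 1 ∤ 3·7ⁿ;
ℚ(15A[2^∞]) is pro-2). Imported areas: cyclotomic Iwasawa theory / Euler systems (Kato,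
Kobayashi2003, Pollack2003, Kurihara2002),
computational number theory (exact modular symbols, p-adic L-series invariants: PARI
`ellpadiclambdamu`, `msfromell`), modularity
switching (Thorne2016, FreitasLeHungSiksek2015). Versus the 46 open routes: none uses Mordell–Weil
stabilisation in a tower or an
L-value certificate; SqrtFiveQuarticCovers (same sector family, quartic fields) uses
gonality/Chabauty, FifteenLocusEisenstein
(imaginary quadratic) uses Eisenstein lifting at 5; the negatives index (OrdinaryPrimeTransport pole
count, K3 Serre-type anchor) is untouched.

RANKED CRUXES. #0 Target (target) — every elliptic curve (integral Weierstrass model, Δ ≠ 0) over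
every totally real number field admitting a ring embedding into some ℚ(ζ_{7^{n+1}}) is modular
(Caraiani–Newton rendering inlined). (why it might fail: only if 15A gains rank somewhere in the
tower AND one of the new j's carries a genuinely non-modular curve — i.e. Langlands fails; the real
risk is unprovability of the Mordell–Weil control, not falsity.) [Thorne2019, Yoshikawa2022,
Yoshikawa2019, FreitasLeHungSiksek2015]
#2 NonvanishingSevenTwists (crux) — [computational certificate] for E = X₀(15)/ℚ in the Legendre
model y² = x(x+16)(x+25) (inlined as ⟨0, 41, 0, 400, 0⟩, definitionally `X0FifteenLegendre`, ≅ 15A1)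
and every EVEN primitive Dirichlet character χ of conductor 7^{k+1}, every entire continuation of
the twisted Hasse–Weil L-series L(E, χ, s) = Σ χ(n) aₙ(E) n⁻ˢ (Mathlib `WeierstrassCurve.LFunction`
coefficients; agreement on Re s > 2) is non-zero at s = 1 — by modularity of X₀(15) this is L(f₁₅ ⊗
χ, 1) ≠ 0 for the newform f₁₅ spanning S₂(Γ₀(15)) (REROUTED 2026-08-17 from the
`IsNewform0`/`twistedLSeries` phrasing; Mathlib-only now, and literally the quantity Kato/Rohrlich
consume). Certificate: a₇(15A) = 0, so Pollack's plus/minus 7-adic L-functions on the even branches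
ω⁰, ω², ω⁴ interpolate all these values; μ^± = 0 + Newton slopes ≠ 1/(6·7^{m−1}) + finitely many
exact Birch modular-symbol sums ≠ 0 (kit/PARI job j020997 queued at filing; local numerics: all 1028
even primitive twists of conductor ≤ 7⁴ non-zero, conductor-7 algebraic value exactly 2).
[difficulty: M] (why it might fail: an even twist L(E,χ,1), cond χ = 7^m, may genuinely vanish
(cubic twists vanish on a thin set — David–Fearnley–Kisilevsky), killing the tower above that layer;
μ>0 or a Newton slope exactly 1/(6·7^{m−1}) defeats the certificate; unfolding Mathlib's tprod
`LFunction` to aₙ(15A) is unbuilt API.) [Pollack2003, Kobayashi2003, Kurihara2002,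
MazurTateTeitelbaum1986Invent, RohrlichInventiones1984, Thorne2019, Kato2004Asterisque]
#3 OddDegreeDoor (crux) — for K totally real embedding in some ℚ(ζ_{7^{n+1}}) (cyclic of odd degree
| 3·7ⁿ, √5 ∉ K): if every K-point of X₀(15) (Legendre model, inlined base change of ⟨0, 41, 0, 400,
0⟩; Iff.rfl-equivalent to the first filing) is torsion and every torsion K-point is one of the eight
rational ones, then every elliptic curve over K is modular (rendering of `Target`). Chain:
Thorne2016 Thm 7.6 (ρ̄₅ irreducible), Langlands–Tunnell + FreitasLeHungSiksek2015 Thm 2 (p = 3),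
else a K-point of X₀(15) or X(s3,b5) ≅ 15A3, ℚ-rational by the hypothesis + Yoshikawa2022 Lemma
3.2/Cor. 3.3 ([K:ℚ] odd), so j(E) ∈ ℚ and E is a quadratic twist of (E₀)_K with E₀/ℚ modular (BCDT,
tree fact `exists_isNewformOf` — proof-time input), base-changed along the cyclic tower
(`baseChange_cyclic_cuspidal`, RepData vocabulary) and twisted. [difficulty: L] (why it might fail:
the tree's 'modular' (weight-zero cuspidal π over K, cofinite trace match) must be produced from
base change + twist by tree facts; Thorne 7.6 / FLS Thm 2 may hide a local hypothesis at 5 or 3 for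
additive E (cf. Yoshikawa2019 Prop. 1.4 exceptions).) [Thorne2016, FreitasLeHungSiksek2015,
Yoshikawa2022, Thorne2019, Langlands1980, BreuilConradDiamondTaylor2001]
#4 KatoRankZeroSeven (crux) — Kato's step — assuming `NonvanishingSevenTwists`, for every totally
real K embedding in some ℚ(ζ_{7^{n+1}}), every K-point of X₀(15) (Legendre model, inlined;
Iff.rfl-equivalent to the first filing modulo the rephrased hypothesis) has finite order: E(K) ⊗ ℚ̄
= ⊕_{χ ∈ X(K)} (E(K) ⊗ ℚ̄)^χ over the even 7-power-conductor characters of the cyclic field K; the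
trivial part is E(ℚ) ⊗ ℚ = 0 (rank 0), and for χ ≠ 1, L(E, χ, 1) ≠ 0 plus Kato2004Asterisque Thm
14.2 / Cor. 14.3 (auxiliary good ordinary p ∤ 30·[K:ℚ]) kill the χ-part of Selmer over ℚ(χ) ⊂ K.
[deps: NonvanishingSevenTwists] [difficulty: L] (why it might fail: Kato's Cor. 14.3 is printed for
χ-Selmer groups of lattices in V_p(f)(1) over ℚ(ζ_N) with side conditions on p (p ∤ 6N·cond χ,
image); turning 'finite χ-Selmer for one p' into 'no point of infinite order over K' needs the
χ-isotypic Kummer injection — routine, unvendored.) [Kato2004Asterisque, RohrlichInventiones1984,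
GreenbergLNM1716, Thorne2019, CaraianiNewton2023]
#5 TorsionSeven (crux) — torsion rigidity — for every totally real K embedding in some
ℚ(ζ_{7^{n+1}}), every torsion K-point of X₀(15) (Legendre model, inlined; Iff.rfl-equivalent to the
first filing) is one of O, (0,0), (−16,0), (−25,0), (20,±180), (−20,±20): X₀(15)(ℚ) ≅ ℤ/2 × ℤ/4 is
exactly these; for odd ℓ, ρ̄_{15A,ℓ}(G_ℚ) = GL₂(𝔽_ℓ) and a new K-rational ℓ-torsion point would
force an index dividing both ℓ² − 1 (even) and [K:ℚ] | 3·7ⁿ (odd) — impossible; ℚ(E[2^∞])/ℚ is pro-2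
and meets K in ℚ. [difficulty: M] (why it might fail: needs ρ̄_{15A,ℓ}(G_ℚ) = GL₂(𝔽_ℓ) for every odd
ℓ (LMFDB/Serre for the semistable class 15a); if the image were smaller at some ℓ the orbit-parity
argument must be redone with the true image — low risk, but an input to vendor.) [Yoshikawa2022,
Thorne2019, CaraianiNewton2023, Serre1972]
#9 SectorComplement (crux) — the honest name for the rest of the summit: X (every elliptic curve
over every totally real subfield of ℚ(ζ_{7^∞}) is modular) → Langlands. Trivially implied by
`Langlands`; it contains direction (A), every (n, F) other than (2, F ⊂ ℚ(ζ_{7^∞})⁺, V_ℓE),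
local–global compatibility at every place and the data 𝓡. Refuters/graders: judge the route on
NonvanishingSevenTwists / OddDegreeDoor / KatoRankZeroSeven, never on this item; never staffed from
this route. [deps: Target] [difficulty: open-problem] (why it might fail: it is the rest of the
summit (direction (A), every other (n, F), local–global compatibility, the data 𝓡):
conjecture-grade, unprovable short of Langlands itself; never staffed from this route — graders
judge the three ranked cruxes.) [BuzzardGeeLMS2014, Thorne2019]

TWO-LAYER PLAN. If NonvanishingSevenTwists is certified TRUE in the expected shape (λ^± = μ^± = 0 on
the even branches), it splits as
UnitConstantTerms (the three exact algebraic L-values are 7-adic units: finite, `norm_num`-grade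
once modular symbols of level 15 are
tabulated) → PollackInterpolation (named fact: L₇^± interpolate the even 7-power twists with
explicit non-zero factors; a unit power
series has no zeros) → NonvanishingSevenTwists (k = 2, depth 1). OddDegreeDoor splits as
NonModularLocus15 (E/K not modular, K
totally real, √5 ∉ K ⇒ E gives a K-point of X₀(15) or X(s3,b5): Thorne2016 + FLS, a vendorable
theorem) → RationalJModular (j ∈ the
four rational j's ⇒ modular over abelian K: base change + twist) → OddDegreeDoor. KatoRankZeroSeven
splits as KatoTwistedFinite (vendor
Kato Cor. 14.3 for twists of the level-15 newform) → IsotypicDescent (finite χ-Selmer for all χ ∈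
X(K) ⇒ E(K) torsion). The same
three-crux machine with '7^{k+1}' replaced by an arbitrary odd conductor set certifies, field by
field, every odd-degree abelian totally
real field whose finitely many even twisted values are non-zero (e.g. ℚ(ζ₇)⁺·ℚ(ζ₁₁)⁺-type fields
ramified at 7, outside Yoshikawa2019);
those are later routes/items, not filed now.

KILL CRITERIA. A certified VANISHING L(E, χ, 1) = L(f₁₅ ⊗ χ, 1) = 0 for an even χ of conductor 7^m
refutes NonvanishingSevenTwists: close
`refuted:NonvanishingSevenTwists` if m = 1 (15A has positive rank over ℚ(ζ₇)⁺: the tower dies at its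
base; pivot = restate Target for
the ℤ₇-tower over ℚ(ζ₇)⁺ only if the vanishing sits on a Γ-twist instead); if m ≥ 2, restate Target
to the layers below 7^m (route
survives as a finite-layer theorem, honestly smaller). A refutation of OddDegreeDoor by an API
witness (base change or twist not
expressible in the tree's `IsModularEllipticCurve` rendering) is a STATEMENT-AUDIT finding, not a
pivot. Mooted if someone proves
modularity of all elliptic curves over all abelian (or all odd-degree) totally real fields (e.g. a
Skinner–Wiles door at 3 without the
semistability hypothesis), or Serre's conjecture over totally real fields.

NOT DECOMPOSED YET. The vendoring of Kato's twisted theorem, Pollack's interpolation formula and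
Thorne's Thm 7.6 as named Literature facts (cite items to
be filed after open); the in-kernel tabulation of the level-15 modular symbols (a definition-grade
item: `normalizedPlusSymbol` values at
the 6 + 42 + 294 cusps a/7^k); the image statement ρ̄_{15A,ℓ} = GL₂(𝔽_ℓ) for odd ℓ (Serre + no odd
isogeny) — all layer-2 children or
supports, filed when the certificate returns. No regime split is hidden: the whole tower is one
statement. REROUTE 2026-08-17 (cone repair, planner-rrepair): the route file now imports only the
summit Statement's cone — the Legendre model is inlined as ⟨0, 41, 0, 400, 0⟩ (definitionally
`X0FifteenLegendre`; OddDegreeDoor, KatoRankZeroSeven, TorsionSeven are Iff.rfl-equivalent to their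
first filing) and NonvanishingSevenTwists is stated on the Hasse–Weil L-series of X₀(15) (Mathlib
`WeierstrassCurve.LFunction`) instead of the newform f₁₅ (modules CaraianiNewtonModularity and
CuspFormLFunction dropped: their import cone carried 23 unproved named facts, none of them a
statement dependency). PROOF-TIME named facts this line genuinely leans on (needs-fact, tier-0 debt;
not imported by the route file):
`Literature.NumberTheory.EllipticCurves.ModularForms.exists_isNewformOf` (BCDT — modularity of the
rational-j curves in OddDegreeDoor; aₙ(X₀(15)) = aₙ(f₁₅) for the certificate and the Kato step). Not
needed: `existsUnique_isNewformOf`, the HasseWeilAbelian conductor/Euler-factor facts, Sweep1's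
`exists_cuspidal_baseChange_of_not_dvd` (base change is taken in the RepData vocabulary,
`baseChange_cyclic_cuspidal`), `exists_isCMField_isModular`, `exists_cuspidal_symmetricPower`,
`CaraianiNewton2023_modularity`.

CHEAPEST FALSIFIER. (a) Lookup (2026-08-17): Thorne2019 = ℤ_p-towers of ℚ; Zhang2023, Yoshikawa2022
(arXiv:2206.12860, read: real QUADRATIC base,
p ∤ 30d, unit-L-value hypothesis); Yoshikawa2019 (doi:10.5802/jtnb.1047, read: needs 3, 5 AND 7
unramified; the inertia trick uses that
B(𝔽₇) has no element of order 4) = abelian fields unramified at 3,5,7, hence all real p-cyclotomic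
towers with p ≥ 11;
DerickxNajmanSiksek2020 = the cubic base only. Nothing found for ℚ(ζ₄₉)⁺ (degree 21) or above
(crossref/zbmath/s2; `lit citing
doi:10.4171/jems/877`: 3 works, none relevant).
(b) The decisive computation, RUN locally in part (compute/twistL_numeric.py: smoothed functional
equation, a_n by point counting,
truncation < 1e-29; results in compute/twistL_numeric_results.txt): NO even primitive twist of
conductor 7, 49, 343, 2401 vanishes
(2 + 18 + 126 + 882 characters; min |L(E,χ,1)| = 2.12, 0.373, 0.0127, 0.0147), and for the cubic
pair at conductor 7 the algebraic
part L(E,χ,1)τ(χ̄)/Ω⁺ is EXACTLY 2, a 7-adic unit. The exact / 7-adic half (`msfromell` Birch sums,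
`ellpadiclambdamu` on branches
ω^0..ω^5) is kit job j020997 (PARI 2.15), queued at filing; attached as evidence when it lands.

NUMBERS. 15A1 = X₀(15): conductor 15, L(15A,1)/Ω = 1/8, c₃·c₅ = 8, X₀(15)(ℚ) ≅ ℤ/2×ℤ/4 (Legendre
model points O, (0,0), (−16,0), (−25,0), (20,±180),
(−20,±20)), a₇ = 0, ρ̄_ℓ surjective for ℓ ≥ 3 (Yoshikawa2022 Lemma 4.1). Tower: [ℚ(ζ_{7^{n+1}})⁺ :
ℚ] = 3·7ⁿ (3, 21, 147, …); even characters
of conductor 7^{k+1}: 3·7^k of them, primitive ones 3·7^k − 3·7^{k−1} (k ≥ 1), 2 for k = 0 (the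
cubic pair ω², ω⁴). Candidate zero
locations: v₇(ζ_{7^m} − 1) = 1/(6·7^{m−1}). Yoshikawa2022 Table 1 (quadratic analogue):
L(X₀(15)^d,1)/Ω ∈ {0, 1, 2, 4, 8, 16} for d ≤ 41 —
vanishing does occur for quadratic twists (d = 3, 7, 10, 11, 13, …), a reminder that the cubic pair
at conductor 7 is a genuine bet.
Job cost: < 1 core-minute (modular symbols of level 15; 147 characters at conductor 343). Items at
open: 7.

DEFINITION REQUESTS. Cite facts to file after open (kind cite, family lang): (1) Kato2004Asterisque
Thm 14.2 / Cor. 14.3 for twists of weight-2 newforms by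
Dirichlet characters (finiteness of the χ-part of Selmer/Mordell–Weil over ℚ(ζ_N) when L(f,χ,1) ≠
0); (2) Pollack2003 (plus/minus p-adic
L-functions at a supersingular prime with a_p = 0: integrality, interpolation of twists of p-power
conductor on each ω^i-branch);
(3) Thorne2016 Thm 7.6 and FreitasLeHungSiksek2015 Thm 2 (p = 3) in the tree's
`IsModularEllipticCurve` rendering; (4) cyclic base
change of weight-zero cuspidal π of GL₂ along a cyclic extension of totally real fields
(Langlands1980) in the `CuspidalAutomorphicRepData`
vocabulary. No new Lean notion is needed for the statements as filed (after the 2026-08-17 reroute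
every constant is Mathlib or in the summit
Statement's cone: `WeierstrassCurve.LFunction`, `LSeries`, `DirichletCharacter.IsPrimitive`,
`CyclotomicField`, `WeierstrassCurve.Affine.Point`,
`IsOfFinAddOrder`, `NumberField.IsTotallyReal`, `CuspidalAutomorphicRepData`, `frobTraceAt`; the
Legendre model is inlined). Optional hygiene
(not filed): relocate `X0FifteenLegendre` to a fact-free module so the four X₀(15) routes can share
the constant without importing Caraiani–Newton.

Novelty: Searches (2026-08-16/17): `lit search --source s2 "elliptic curves over Zp-extensions of real
quadratic fields are modular"` (15: Zhang2023,
Yoshikawa2022 found and READ; Kundu–Lei growth; Dasgupta–Khan analytic ranks over cyclotomic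
fields); `lit search --source crossref
"Modularity of elliptic curves over abelian totally real fields unramified at 3, 5, and 7"` (10:
Yoshikawa2019 found and READ, DNS2020,
IshitsukaItoYoshikawa2022); `lit search --source crossref --year-from 2019 "modularity elliptic
curves totally real cyclotomic fields Iwasawa
theory Kato twisted L-values non-vanishing"` (15; nothing on 7-ramified abelian fields); `lit citing
doi:10.4171/jems/877` (3);
`lit search --source zbmath "van Geemen Top …"` (drop of an earlier candidate: IKM
arXiv:1811.11544); `lit galaxy search "real quadratic
fields are modular" --star all` (6, none relevant), two broader galaxy phrasings (0); all 46 open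
route headers + closed_tonight read
(levers listed in NOTES); `lean search` for IsTotallyReal / CyclotomicField / X0FifteenLegendre /
IsNewform0 / twistedLSeries /
kato_* / Rohrlich1984_*; ledger negatives (2, untouched).
Nearest prior art found: Thorne2019 (doi:10.4171/jems/877: the ℤ_p-towers of ℚ via
Kato–Greenberg–Kurihara for 15A and X(s3,b5));
Yoshikawa2022 (arXiv:2206.12860: ℤ_p-towers of real quadratic fields under a unit-L-value
hypothesis, p ∤ 30d); Yoshikawa2019
(doi:10.5802/jtnb.1047: abelian fields unramified at 3,5,7 by the Skinner–Wiles door — no point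
control at a  [refs: 10.4171/jems/877`, 10.4171/jems/877:, 10.5802/jtnb.1047:, 1811.11544, 2206.12860, doi:10.4171/jems/877, doi:10.5802/jtnb.1047, Zhang2023, Yoshikawa2022, Yoshikawa2019, Thorne2019]

Barriers (technique_class: iwasawa-tower-control certified-nonvanishing switching): - technique_class: iwasawa-tower-control certified-nonvanishing switching
- Literature.Barriers.Langlands.ResiduallyReducibleBarrier: evaded, not met — the residually
reducible curves (ρ̄_{E,5}, ρ̄_{E,3} small) are never lifted; they are located on X₀(15)/X(s3,b5),
shown to have rational j by Mordell–Weil control, and handled by base change of a curve over ℚ.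
- Literature.Barriers.Langlands.ResiduallyReducibleBarrierNarrow: same evasion — no residually
reducible deformation problem is posed anywhere in the route.
- Literature.Barriers.Langlands.PatchingLocalComponentBarrier: not engaged by the new cruxes; it
lives inside the cited lifting theorems (potentially Barsotti–Tate / ordinary at 3 and 5,
Thorne2016, FLS), whose printed hypotheses OddDegreeDoor must respect (its why-might-fail).
- Literature.Barriers.Langlands.PatchingLocalComponentBarrierNarrow: as above; at the ramified prime
7 nothing is lifted 7-adically — 7 enters only through the Iwasawa theory of one curve over ℚ.
- Literature.Barriers.Langlands.ModPLanglandsGL2BeyondQpFpBar: not met — no p-adic or mod-p local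
Langlands correspondence is used at any place.
- Literature.Barriers.Langlands.BreuilPaskunas2012_supersingularFamily: not met — the supersingular
prime 7 of 15A is treated by plus/minus p-adic L-functions of a curve over ℚ (Pollack/Kobayashi),
not by supersingular representation theory of GL₂(F_v).
- Literature.Barriers.Langlands.NonRegularWeightBarrier: not evaded, by design — elliptic curves are
regula

History (route lifecycle, newest last):
- 2026-08-17T00:54:49Z · rev 1: restated NonvanishingSevenTwists (stmt-Langlands-16839), OddDegreeDoor (stmt-Langlands-16840), KatoRankZeroSeven (stmt-Langlands-16841), TorsionSeven (stmt-Langlands-16842) — route-repair (cone): reroute around the 23 unproved named facts of the import cone — imports CaraianiNewtonModularity + CuspFormLFunction  (planner-rrepair-Langlands-HeptagonalTower-427d62db-0)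
- 2026-08-24T21:53:32Z · DORMANT — reconciler: no traction for 7.1 d (last activity statement-claimed at 2026-08-17T18:51:59Z); parked, not closed — `ledger route dormant route-Langlands-Heptagon (operator:999:1624296)
- 2026-08-28T21:08:52Z · REACTIVATED — reconciler: reactivated — activity statement-checked at 2026-08-28T19:08:39Z after parking at 2026-08-24T21:53:32Z (operator:999:1752143)
- 2026-09-03T09:42:25Z · DORMANT — reconciler: no traction for 5 d (last activity statement-checked at 2026-08-29T08:49:52Z); parked, not closed — `ledger route dormant route-Langlands-Heptagonal (operator:999:3913464)

sub-problem: Langlands · status: dormant · opened planner-plan-novel-Langlands-Langlands-e266a39d-d-v2-g12-0 2026-08-17T00:30:58Z · rev 3 · ledger route-Langlands-HeptagonalTower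
GENERATED by the gate from the ledger (D-0016/17). Provers cite these decls: `theorem foo : Summit.Langlands.Langlands.Theses.HeptagonalTower.<Decl> := …` in Summits/Langlands/Langlands/Theorems/<Name>.lean.
-/

namespace Summit.Langlands.Langlands.Theses.HeptagonalTower

open scoped BigOperators Topology Manifold Classical MeasureTheory ProbabilityTheory Matrix InnerProductSpace ComplexConjugate ContinuousMap
open Filter Set Function TopologicalSpace MeasureTheory

attribute [summit_statement] _root_.Langlands

/-- item stmt-Langlands-16838 · target · rank 0 · open · by planner
why it might fail: only if 15A gains rank somewhere in the tower AND one of the new j's carries a genuinely non-modular curve — i.e. Langlands fails; the real risk is unprovability of the Mordell–Weil control, not falsity.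
sources: Thorne2019, Yoshikawa2022, Yoshikawa2019, FreitasLeHungSiksek2015
[target] every elliptic curve (integral Weierstrass model, Δ ≠ 0) over every totally real number
field admitting a ring embedding into some ℚ(ζ_{7^{n+1}}) is modular (Caraiani–Newton rendering
inlined). -/
@[route_item "route-Langlands-HeptagonalTower"]
def Target : Prop :=
  ∀ (K : Type) [Field K] [NumberField K], NumberField.IsTotallyReal K → (∃ n : ℕ, Nonempty (K →+* CyclotomicField ((7 : ℕ+) ^ (n + 1)) ℚ)) → ∀ E : WeierstrassCurve (NumberField.RingOfIntegers K), E.Δ ≠ 0 → ((E.baseChange K).HasCM ∨ ∃ (hF : Literature.NumberTheory.Automorphic.isCompact_glFiniteIntegralLevel 2 K) (π : Literature.NumberTheory.Automorphic.CuspidalAutomorphicRepData 2 K hF), π.1.HasWeightZero ∧ ∀ᶠ w : IsDedekindDomain.HeightOneSpectrum (NumberField.RingOfIntegers K) in Filter.cofinite, ∃ α : Multiset ℂ, π.1.HasSatakeParamAt w α ∧ ((Real.sqrt w.residueCard : ℝ) : ℂ) * α.sum = (Literature.NumberTheory.Automorphic.frobTraceAt E w : ℂ))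

-- earlier NonvanishingSevenTwists (stmt-Langlands-16839, replaced 2026-08-17T00:54:49Z -> stmt-Langlands-16986): retired by None — ∀ (f : CuspForm (CongruenceSubgroup.Gamma0 15) 2), Literature.NumberTheory.EllipticCurves.ModularForms.IsNewform0 f → ∀ (k : ℕ) (χ : DirichletCharacter ℂ (7 ^ (k + 1))), χ.IsPrimitive → χ (-1) = 1 → ∀ L : ℂ → ℂ, Differentiable ℂ L → (∀ s : ℂ, 2 < s.re → L s = Literature.
/-- item stmt-Langlands-16986 · crux · rank 2 · open · by planner
why it might fail: an even twist L(E,χ,1), cond χ = 7^m, may genuinely vanish (cubic twists vanish on a thin set — David–Fearnley–Kisilevsky), killing the tower above that layer; μ>0 or a Newton slope exactly 1/(6·7^{m−1}) defeats the certificate; unfolding Mathlib's tprod `LFunction` to aₙ(15A) is unbuilt API.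
sources: Pollack2003, Kobayashi2003, Kurihara2002, MazurTateTeitelbaum1986Invent, RohrlichInventiones1984, Thorne2019
[crux] [computational certificate] Let E = X₀(15) over ℚ in the Legendre model y² = x(x+16)(x+25) =
x³ + 41x² + 400x (inlined as ⟨0, 41, 0, 400, 0⟩; definitionally the tree's `X0FifteenLegendre`;
ℚ-isomorphic to Cremona 15A1) and let aₙ(E) be the Dirichlet coefficients of its Hasse–Weil
L-function (Mathlib `WeierstrassCurve.LFunction`: the Euler product over all primes of the local
factors of minimal models — good, split/non-split multiplicative, additive). For every EVEN
primitive Dirichlet character χ of conductor 7^{k+1}, k ≥ 0, every entire function agreeing with the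
twisted L-series L(E, χ, s) = Σ χ(n) aₙ(E) n⁻ˢ on Re s > 2 is non-zero at s = 1 — i.e. L(E, χ, 1) ≠
0 (the series converges absolutely there by the trivial bound |a_p| ≤ p + 1; the continuation exists
and is unique, so the statement is neither vacuous nor junk-valued). By modularity of X₀(15)
(Eichler–Shimura at level 15; aₙ(E) = aₙ(f₁₅) for the newform f₁₅ spanning S₂(Γ₀(15))) this is L(f₁₅
⊗ χ, 1) ≠ 0, the form in which the certificate is computed. REROUTED 2026-08-17 (cone repair):
formerly quantified over `IsNewform0 f`, f ∈ S₂(Γ₀(15)), via `twistedLSeries` (module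
CuspFormLFunction, whose import cone carries u -/
@[route_item "route-Langlands-HeptagonalTower"]
def NonvanishingSevenTwists : Prop :=
  ∀ (k : ℕ) (χ : DirichletCharacter ℂ (7 ^ (k + 1))), χ.IsPrimitive → χ (-1) = 1 → ∀ L : ℂ → ℂ, Differentiable ℂ L → (∀ s : ℂ, 2 < s.re → L s = LSeries (fun n ↦ χ n * ((({ a₁ := 0, a₂ := 41, a₃ := 0, a₄ := 400, a₆ := 0 } : WeierstrassCurve ℚ).LFunction n : ℤ) : ℂ)) s) → L 1 ≠ 0

-- earlier OddDegreeDoor (stmt-Langlands-16840, replaced 2026-08-17T00:54:49Z -> stmt-Langlands-16987): retired by None — ∀ (K : Type) [Field K] [NumberField K], NumberField.IsTotallyReal K → (∃ n : ℕ, Nonempty (K →+* CyclotomicField ((7 : ℕ+) ^ (n + 1)) ℚ)) → (∀ P : (Literature.NumberTheory.Automorphic.X0FifteenLegendre.baseChange K).toAffine.Point, IsOfFinAddOrder P) → (∀ (x y : K) (h : (Literature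
/-- item stmt-Langlands-16987 · crux · rank 3 · open · by planner
why it might fail: the tree's 'modular' (weight-zero cuspidal π over K, cofinite trace match) must be produced from base change + twist by tree facts; Thorne 7.6 / FLS Thm 2 may hide a local hypothesis at 5 or 3 for additive E (cf. Yoshikawa2019 Prop. 1.4 exceptions).
sources: Thorne2016, FreitasLeHungSiksek2015, Yoshikawa2022, Thorne2019, Langlands1980, BreuilConradDiamondTaylor2001
[crux] let K be a totally real number field embedding in some ℚ(ζ_{7^{n+1}}) (so K/ℚ is cyclic of
odd degree dividing 3·7ⁿ and √5 ∉ K). If every K-point of X₀(15) — the Legendre model y² =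
x(x+16)(x+25), inlined as the base change to K of ⟨0, 41, 0, 400, 0⟩ : WeierstrassCurve ℚ
(definitionally `X0FifteenLegendre.baseChange K`; REROUTED 2026-08-17, statement Iff.rfl-equivalent
to the original) — is torsion and every torsion K-point is one of O, (0,0), (−16,0), (−25,0),
(20,±180), (−20,±20), then every elliptic curve over K is modular (Caraiani–Newton rendering
inlined, as in `Target`). Chain: ρ̄_{E,5} irreducible ⇒ modular (Thorne2016 Thm 7.6, √5 ∉ K);
ρ̄_{E,5} reducible and ρ̄_{E,3}(G_{K(ζ₃)}) absolutely irreducible ⇒ modular (Langlands–Tunnell +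
FreitasLeHungSiksek2015 Thm 2 at p = 3); otherwise ρ̄_{E,3} is Borel or in the normaliser of a split
Cartan (K ∩ ℚ(ζ₃) = ℚ) and E defines a K-point of X₀(15) = X(b3,b5) or of X(s3,b5) ≅ 15A3; by the
hypothesis and Yoshikawa2022 Lemma 3.2/Cor. 3.3 (the 2-isogeny X(s3,b5) → X₀(15) over ℚ; preimages
of ℚ-points are at most quadratic, [K:ℚ] odd) that point is ℚ-rational, so j(E) ∈ ℚ∖{0,1728} and E
is a quadratic twist over K of (E₀)_K for an e -/
@[route_item "route-Langlands-HeptagonalTower"]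
def OddDegreeDoor : Prop :=
  ∀ (K : Type) [Field K] [NumberField K], NumberField.IsTotallyReal K → (∃ n : ℕ, Nonempty (K →+* CyclotomicField ((7 : ℕ+) ^ (n + 1)) ℚ)) → (∀ P : (({ a₁ := 0, a₂ := 41, a₃ := 0, a₄ := 400, a₆ := 0 } : WeierstrassCurve ℚ).baseChange K).toAffine.Point, IsOfFinAddOrder P) → (∀ (x y : K) (h : (({ a₁ := 0, a₂ := 41, a₃ := 0, a₄ := 400, a₆ := 0 } : WeierstrassCurve ℚ).baseChange K).toAffine.Nonsingular x y), IsOfFinAddOrder (WeierstrassCurve.Affine.Point.some x y h) → (x = 0 ∧ y = 0) ∨ (x = -16 ∧ y = 0) ∨ (x = -25 ∧ y = 0) ∨ (x = 20 ∧ y = 180) ∨ (x = 20 ∧ y = -180) ∨ (x = -20 ∧ y = 20) ∨ (x = -20 ∧ y = -20)) → ∀ E : WeierstrassCurve (NumberField.RingOfIntegers K), E.Δ ≠ 0 → ((E.baseChange K).HasCM ∨ ∃ (hF : Literature.NumberTheory.Automorphic.isCompact_glFiniteIntegralLevel 2 K) (π : Literature.NumberTheory.Automorphic.CuspidalAutomorphicRepData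 2 K hF), π.1.HasWeightZero ∧ ∀ᶠ w : IsDedekindDomain.HeightOneSpectrum (NumberField.RingOfIntegers K) in Filter.cofinite, ∃ α : Multiset ℂ, π.1.HasSatakeParamAt w α ∧ ((Real.sqrt w.residueCard : ℝ) : ℂ) * α.sum = (Literature.NumberTheory.Automorphic.frobTraceAt E w : ℂ))

-- earlier KatoRankZeroSeven (stmt-Langlands-16841, replaced 2026-08-17T00:54:49Z -> stmt-Langlands-16988): retired by None — NonvanishingSevenTwists → ∀ (K : Type) [Field K] [NumberField K], NumberField.IsTotallyReal K → (∃ n : ℕ, Nonempty (K →+* CyclotomicField ((7 : ℕ+) ^ (n + 1)) ℚ)) → ∀ P : (Literature.NumberTheory.Automorphic.X0FifteenLegendre.baseChange K).toAffine.Point, IsOfFinAddOrder P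
/-- item stmt-Langlands-16988 · crux · rank 4 · open · by planner
why it might fail: Kato's Cor. 14.3 is printed for χ-Selmer groups of lattices in V_p(f)(1) over ℚ(ζ_N) with side conditions on p (p ∤ 6N·cond χ, image); turning 'finite χ-Selmer for one p' into 'no point of infinite order over K' needs the χ-isotypic Kummer injection — routine, unvendored.
sources: Kato2004Asterisque, RohrlichInventiones1984, GreenbergLNM1716, Thorne2019, CaraianiNewton2023
[crux] Kato's step — assuming `NonvanishingSevenTwists` (now stated on L(E, χ, s) of E = X₀(15)
itself), for every totally real K embedding in some ℚ(ζ_{7^{n+1}}), every K-rational point of X₀(15)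
(Legendre model, inlined as the base change to K of ⟨0, 41, 0, 400, 0⟩ : WeierstrassCurve ℚ —
definitionally `X0FifteenLegendre.baseChange K`; REROUTED 2026-08-17, Iff.rfl-equivalent to the
original modulo the new phrasing of the hypothesis) has finite order. Chain: K/ℚ cyclic with
character group X(K) ⊂ {even Dirichlet characters of 7-power conductor}; E(K) ⊗ ℚ̄ = ⊕_{χ ∈ X(K)}
(E(K) ⊗ ℚ̄)^χ; the trivial part is E(ℚ) ⊗ ℚ = 0 (rank 0 over ℚ: L(E,1) = Ω/8 ≠ 0 and Kolyvagin/Kato,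
or classical 2-descent); for χ ≠ 1, L(E, χ, 1) ≠ 0 (the hypothesis, after exhibiting the entire
continuation of L(E, χ, s): modularity of X₀(15) + Hecke) and Kato's theorem (Kato2004Asterisque Thm
14.2 / Cor. 14.3 for the newform of E twisted by χ, any auxiliary good ordinary prime p ∤ 30·[K:ℚ],
e.g. p = 11 or 13; Rohrlich's formulation for modular elliptic curves over ℚ) give finiteness of the
χ-part of the p^∞-Selmer group over ℚ(χ) ⊂ K, hence (E(K) ⊗ ℚ̄)^χ = 0; so E(K) is torsion. [deps:
NonvanishingSevenTwists] -/
@[route_item "route-Langlands-HeptagonalTower"]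
def KatoRankZeroSeven : Prop :=
  NonvanishingSevenTwists → ∀ (K : Type) [Field K] [NumberField K], NumberField.IsTotallyReal K → (∃ n : ℕ, Nonempty (K →+* CyclotomicField ((7 : ℕ+) ^ (n + 1)) ℚ)) → ∀ P : (({ a₁ := 0, a₂ := 41, a₃ := 0, a₄ := 400, a₆ := 0 } : WeierstrassCurve ℚ).baseChange K).toAffine.Point, IsOfFinAddOrder P

-- earlier TorsionSeven (stmt-Langlands-16842, replaced 2026-08-17T00:54:49Z -> stmt-Langlands-16989): retired by None — ∀ (K : Type) [Field K] [NumberField K], NumberField.IsTotallyReal K → (∃ n : ℕ, Nonempty (K →+* CyclotomicField ((7 : ℕ+) ^ (n + 1)) ℚ)) → ∀ (x y : K) (h : (Literature.NumberTheory.Automorphic.X0FifteenLegendre.baseChange K).toAffine.Nonsingular x y), IsOfFinAddOrder (WeierstrassCu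
/-- item stmt-Langlands-16989 · crux · rank 5 · open · by planner
why it might fail: needs ρ̄_{15A,ℓ}(G_ℚ) = GL₂(𝔽_ℓ) for every odd ℓ (LMFDB/Serre for the semistable class 15a); if the image were smaller at some ℓ the orbit-parity argument must be redone with the true image — low risk, but an input to vendor.
sources: Yoshikawa2022, Thorne2019, CaraianiNewton2023, Serre1972
[crux] torsion rigidity — for every totally real K embedding in some ℚ(ζ_{7^{n+1}}), every torsion
K-point of X₀(15) (Legendre model y² = x(x+16)(x+25), inlined as the base change to K of ⟨0, 41, 0,
400, 0⟩ : WeierstrassCurve ℚ — definitionally `X0FifteenLegendre.baseChange K`; REROUTED 2026-08-17,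
Iff.rfl-equivalent to the original) is one of the eight rational points O, (0,0), (−16,0), (−25,0),
(20,180), (20,−180), (−20,20), (−20,−20). Proof sketch (elementary given two inputs): X₀(15)(ℚ) ≅
ℤ/2 × ℤ/4 consists of exactly these points (rank 0; 2-torsion = the three roots, (±20, ·) of order
4); for odd ℓ, ρ̄_{15A,ℓ}(G_ℚ) = GL₂(𝔽_ℓ) (no odd isogenies in class 15a; Serre for semistable
curves), a new K-rational ℓ-torsion point would put ρ̄(G_K) inside a point-stabiliser of index ℓ²−1,
but [GL₂(𝔽_ℓ) : ρ̄(G_K)] divides [K:ℚ] | 3·7ⁿ (K/ℚ Galois) and ℓ²−1 is even — impossible; for ℓ = 2,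
E[2] ⊂ E(ℚ) so ℚ(E[2^∞])/ℚ is a pro-2 extension meeting the odd-degree field K in ℚ, whence 2-power
torsion over K is rational; a torsion point is the sum of its primary parts. In-kernel pieces: the
eight points and the group-index arithmetic are `decide`/`norm_num`; the image statement is a named
fact (L -/
@[route_item "route-Langlands-HeptagonalTower"]
def TorsionSeven : Prop :=
  ∀ (K : Type) [Field K] [NumberField K], NumberField.IsTotallyReal K → (∃ n : ℕ, Nonempty (K →+* CyclotomicField ((7 : ℕ+) ^ (n + 1)) ℚ)) → ∀ (x y : K) (h : (({ a₁ := 0, a₂ := 41, a₃ := 0, a₄ := 400, a₆ := 0 } : WeierstrassCurve ℚ).baseChange K).toAffine.Nonsingular x y), IsOfFinAddOrder (WeierstrassCurve.Affine.Point.some x y h) → (x = 0 ∧ y = 0) ∨ (x = -16 ∧ y = 0) ∨ (x = -25 ∧ y = 0) ∨ (x = 20 ∧ y = 180) ∨ (x = 20 ∧ y = -180) ∨ (x = -20 ∧ y = 20) ∨ (x = -20 ∧ y = -20)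

/-- item stmt-Langlands-2175 · crux · rank 9 · open · by planner
why it might fail: it is the rest of the summit (direction (A), every other (n, F), local–global compatibility, the data 𝓡): conjecture-grade, unprovable short of Langlands itself; never staffed from this route — graders judge the three ranked cruxes.
sources: BuzzardGeeLMS2014, Thorne2019
[assembly] Target -> Langlands. GLUE, provable with tree facts as hypotheses where needed: fix F,
take Rec from Target; (A) is the first conjunct verbatim. For (B): given rho irreducible and
Rec-geometric, weak (B) gives pi L-algebraic cuspidal with Satake matching a.e.; (A) applied to pi
gives rho' irreducible geometric with `Corresponds Rec ι π.1 ρ'`; rho and rho' have equal Frobenius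
characteristic polynomials at cofinitely many v (both match the same Satake parameters;
`hasSatakeParamAt` is unique), hence are GL_n(Q̄_l)-conjugate by Chebotarev density + Brauer-Nesbitt
for irreducible l-adic representations (tree: `LAdicRepFrobenius`,
`ReciprocityGLnGaloisConjProofs`); finally `Corresponds Rec ι π.1` is invariant under
`FramedRep.conj g` (Satake clause: `isUnramifiedAt_conj_iff` + charpoly conjugation-invariance;
local-global clause: `PstWeilDeligneData.conj`, conjugation of the Weil-Deligne datum r in
`IsWeilDeligneOfLadic`, `IsTransportAlong`, `HasFrobSemisimpleClass` is a class function). If a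
needed invariance of an accepted predicate is not provable as stated, file it as a support lemma
with `--supports Assembly` rather than weakening Target. -/
@[route_item "route-Langlands-HeptagonalTower"]
def SectorComplement : Prop :=
  Target → _root_.Langlands

/-- item stmt-Langlands-16843 · assembly · rank 1 · closed · proved by Summit.Langlands.Langlands.Theorems.heptagonalTower_assembly_proof @ 61bdfe3121c3 (prover) · by planner
sources: Thorne2019, Yoshikawa2022
[assembly] NonvanishingSevenTwists → KatoRankZeroSeven → OddDegreeDoor → TorsionSeven →
SectorComplement → Langlands (literally the type of `closes`). -/
@[route_item "route-Langlands-HeptagonalTower"]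
def Assembly : Prop :=
  NonvanishingSevenTwists → KatoRankZeroSeven → OddDegreeDoor → TorsionSeven → SectorComplement → _root_.Langlands

-- `Assembly` holds: proved by `Summit.Langlands.Langlands.Theorems.heptagonalTower_assembly_proof` @ 61bdfe3121c3 (its module imports this route file, so no `_holds` link can be stated here).

/-! D-0027 §2.1 — DECIDING THEOREM (planner-authored via `route open/edit --closes-file`; by planner-rrepair-Langlands-HeptagonalTower-unus-a3be9715-0 2026-08-17T08:34:30Z):
its hypotheses are this route's items and its conclusion the sub-problem Statement (glue_lint), and it elaborates with this file. -/

@[closes "route-Langlands-HeptagonalTower"] theorem closes (hA : Assembly) (hNV : NonvanishingSevenTwists) (hK : KatoRankZeroSeven)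
    (hD : OddDegreeDoor) (hT : TorsionSeven) (hC : SectorComplement) : _root_.Langlands :=
  hA hNV hK hD hT hC

end Summit.Langlands.Langlands.Theses.HeptagonalTower
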